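import Literature.NumberTheory.Automorphic.AutomorphicRepsGLCuspFormsRapidDecay
import HarnessLib

/-!
# Inverting a Siegel set: `s⁻¹ = θ a⁻¹` with `θ` in a fixed compact set and `a` in the cone
(Garrett, *Modern Analysis of Automorphic Forms by Example* (2018), Claims 7.3.6–7.3.8, PDF
pp. 335–337; Getz–Hahn (2024), Lemma 9.5.1, printed p. 186)

A brick of the basic estimate for cusp forms on a Siegel set
(`GLnCuspidalSpectrum.norm_smoothedForm_le_of_isSiegelSetGL`, Garrett Thm. 7.3.10). The named fact
evaluates the smoothed form at the classes `[s⁻¹]`, `s ∈ S = Ω · A_{T₀}(t) · K`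
(`IsSiegelSetGL` of `ReductionTheoryGLn`); for `s = ω a k` one has
`s⁻¹ = k⁻¹ (a⁻¹ ω⁻¹ a) · a⁻¹`, and the factor `θ = k⁻¹ (a⁻¹ ω⁻¹ a)` ranges over a *fixed compact
set*, because conjugation by the cone keeps compact subsets of the Borel subgroup bounded: the
entries of `a⁻¹ b a` are `(a_j/a_i, 1) · b_{ij}` with `a_j/a_i ≤ max(1, t⁻¹)^n` for `i ≤ j` and
`b_{ij} = 0` for `i > j` (Garrett, Claim 7.3.6; Getz–Hahn, Lemma 9.5.1: "`s_x⁻¹ x` lies in a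
compact subset"). Everything here is proved:

* `IsSiegelSetGL.exists_isCompact_inv_eq` — **for a Siegel set `S` there are a compact `Θ` and the
  cone parameter `t > 0` with `s⁻¹ ∈ Θ · a⁻¹`, `a ∈ A_{T₀}(t)`, for every `s ∈ S`**, using the
  tree's `exists_isCompact_conj_siegelCone_mem_of_subset` and `isClosed_standardParabolicGL_id`
  (`AutomorphicRepsGLCuspFormsRapidDecay`: conjugates `a⁻¹ b a` of a compact set of upper
  triangular `b` by the cone lie in a compact set; `B(𝔸_K)` is closed).

## References

* P. Garrett, *Modern Analysis of Automorphic Forms by Example* (2018), Claims 7.3.6–7.3.8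
  (PDF pp. 335–337) [Garrett2018].
* J. R. Getz, H. Hahn, *An Introduction to Automorphic Representations* (2024), Lemma 9.5.1
  (printed p. 186) [GetzHahn2024].
-/

noncomputable section

open scoped NNReal MatrixGroups Pointwise RestrictedProduct
open NumberField IsDedekindDomain Set
open _root_.Topology

namespace Literature.NumberTheory.Automorphic

variable {n : ℕ} {K : Type} [Field K] [NumberField K]

/-- **Inverting a Siegel set.** For a Siegel set `S = Ω · A_{T₀}(t) · K ⊆ GL_n(𝔸_K)`
(`IsSiegelSetGL`) there is a compact `Θ ⊆ GL_n(𝔸_K)` such that every `s ∈ S` has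
`s⁻¹ = θ · a⁻¹` with `θ ∈ Θ` and `a ∈ A_{T₀}(t)`: for `s = ω a k`,
`s⁻¹ = k⁻¹ (a⁻¹ ω⁻¹ a) · a⁻¹` with `k⁻¹ ∈ K` (compact, `isCompact_standardMaximalCompactGL`) and
`a⁻¹ ω⁻¹ a` in the compact set of `exists_isCompact_conj_siegelCone_mem_of_subset` applied to
`(closure Ω)⁻¹ ⊆ B(𝔸_K)` (`closure Ω ⊆ B(𝔸_K)`, the Borel subgroup being closed). This is the form
in which the named fact `norm_smoothedForm_le_of_isSiegelSetGL`, which evaluates at the classes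
`[s⁻¹]`, is reduced to points `θ · [a⁻¹]` (Garrett (2018), Claims 7.3.6–7.3.8; Getz–Hahn (2024),
Lemma 9.5.1: `x ∈ s_x Ω_G`). [cite: Garrett2018, Claims 7.3.6–7.3.8 (PDF pp. 335–337)] -/
theorem IsSiegelSetGL.exists_isCompact_inv_eq {S : Set (GL (Fin n) (AdeleRing (𝓞 K) K))}
    (hS : IsSiegelSetGL n K S) :
    ∃ (Θ : Set (GL (Fin n) (AdeleRing (𝓞 K) K))) (t : ℝ), IsCompact Θ ∧ 0 < t ∧
      ∀ s ∈ S, ∃ θ ∈ Θ, ∃ a ∈ siegelCone n K t, s⁻¹ = θ * a⁻¹ := by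
  haveI : T2Space (FiniteAdeleRing (𝓞 K) K) := inferInstanceAs <| T2Space
    (Πʳ w : HeightOneSpectrum (𝓞 K), [w.adicCompletion K, w.adicCompletionIntegers K])
  haveI : T2Space (InfiniteAdeleRing K) :=
    inferInstanceAs <| T2Space ((w : InfinitePlace K) → w.Completion)
  haveI : T2Space (AdeleRing (𝓞 K) K) :=
    inferInstanceAs <| T2Space (InfiniteAdeleRing K × FiniteAdeleRing (𝓞 K) K)
  obtain ⟨Ω, t, ht, hΩ, hc, rfl⟩ := hS
  -- `(closure Ω)⁻¹` is a compact subset of the Borel subgroup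
  have hcl : closure Ω ⊆ (standardParabolicGL (AdeleRing (𝓞 K) K) (id : Fin n → Fin n) :
      Set (GL (Fin n) (AdeleRing (𝓞 K) K))) :=
    closure_minimal (hΩ.trans upperUnitriangular_mul_normOneDiagonal_subset) isClosed_standardParabolicGL_id
  have hB₀ : (closure Ω)⁻¹ ⊆ (standardParabolicGL (AdeleRing (𝓞 K) K) (id : Fin n → Fin n) :
      Set (GL (Fin n) (AdeleRing (𝓞 K) K))) := by
    intro b hb
    have h := hcl (Set.mem_inv.1 hb)
    simpa using Subgroup.inv_mem _ h
  obtain ⟨C, hC, hconj⟩ := exists_isCompact_conj_siegelCone_mem_of_subset ht hB₀ hc.inv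
  refine ⟨(standardMaximalCompactGL n K : Set (GL (Fin n) (AdeleRing (𝓞 K) K)))⁻¹ * C, t,
    (isCompact_standardMaximalCompactGL n K).inv.mul hC, ht, ?_⟩
  rintro _ ⟨_, ⟨ω, hω, a, ha, rfl⟩, k, hk, rfl⟩
  refine ⟨k⁻¹ * (a⁻¹ * ω⁻¹ * a), ⟨k⁻¹, Set.inv_mem_inv.2 hk, a⁻¹ * ω⁻¹ * a,
    hconj a ha ω⁻¹ (Set.inv_mem_inv.2 (subset_closure hω)), rfl⟩, a, ha, ?_⟩
  simp only [mul_inv_rev, mul_assoc, mul_inv_cancel, mul_one]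

end Literature.NumberTheory.Automorphic
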